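import Literature.NumberTheory.EllipticCurves.PAdicLFunctionMinus
import Literature.NumberTheory.EllipticCurves.Kato2004.EulerSystemValues
import HarnessLib

/-!
# Route `ThetaPartnerAtTwo` (TP2), crux K3 `SignedKatoDivisibilityUpToAtTwo` (stmt-BirchSwinnertonDyer-20308 / K3P′ 25631), line
# `colemanrat` v12/v13 — KATO GUARDS AND THE CUSP DICTIONARY for brick B1 (reading `cuspFactor f true χ c d a 2^e d′` on residue classes)

Width seat `bsd-wall-tp2-p2x-w2` g6 (cell `bsd-wall`). HONEST FRAMING: theorems only (no definition, no named fact, no instance, no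
`sorry`); elementary arithmetic; closes no item; K3 / K3P′ are NOT settled and BSD is NOT proved by any of this.

## Why (memo `Cruxes/SignedKatoDivisibilityUpToAtTwo/W2G6-KATO1312-AT2.md`, lead memo `G7-ASSEMBLY-v1.md` §0.5 / B1)

`CuspEval.exists_cuspElement_not_mem(_of_rohrlich)` (`…CuspFactorGeneration(Supply).lean`) produces admissible naturals `c, d` with
`Nat.Coprime c (2·Qc)`, `Nat.Coprime d (2·Qd)` and classes `c̄ = cb`, `d̄ = db ∈ (ℤ/2^e)^×`, and a cusp class `a`, with the four-term element
built from `t(b) = D·[ab/2^e]⁻_f` at `b = 1, cb, db⁻¹, cb·db⁻¹`. Kato's fact (`Kato2004.exists_eulerSystem_expStar_values`, `ZetaBody`)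
wants INTEGER data: guards `Int.gcd c (6·p·A) = 1`, `Int.gcd d (6·p·N) = 1`, `Int.gcd (c·d) (cycLevel p k r · A) = 1`, an inverse
`d·d′ ≡ 1 (mod A)`, and the cusp factor `cuspFactor f true χ c d a A d′` reads the symbols at the rational numbers `a/A, ac/A, ad′/A, acd′/A`.
THIS FILE is the dictionary at `p = 2`, `A = 2^e`: §1 `[m/A]⁻` depends on `m mod A` only (`ratMinusSymbol_intCast_div_eq_of_cast_eq`,
from the tree's periodicity `ratMinusSymbol_add_intCast`), hence the four Kato cusps are the four classes `a, a·cb, a·db⁻¹, a·cb·db⁻¹`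
(`ratMinusSymbol_kato_cusps`); §2 the inverse `d′ := (db⁻¹).val` (`intCast_mul_inv_val_modEq_one`); §3 the guards from the coprimality
(`int_gcd_eq_one_of_coprime_two_three`, `int_gcd_eq_one_of_coprime_two_mul`, `int_gcd_mul_pow_two_eq_one`).

References: [Kato2004Asterisque] K. Kato, Astérisque 295 (2004), Ex. 13.3 (p. 225), Thm. 6.6 (1) (p. 163), Lemma 13.10 (1) (p. 230), §13.12;
[MazurTateTeitelbaum1986Invent] §I.4 (4.2) (periodicity of modular symbols).
-/

set_option autoImplicit false
-- the Theorems namespace of this sub repeats the summit name by design (D-0017 nested layout)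
set_option linter.dupNamespace false

noncomputable section

open scoped BigOperators

open Literature.NumberTheory.EllipticCurves

namespace Summit.BirchSwinnertonDyer.BirchSwinnertonDyer.Theorems.SignedKatoOffTwo.CuspEval

/-! ## §1 The minus symbol of `m/A` depends on `m mod A` only; Kato's four cusps as classes -/

section Cusps

variable {N : ℕ} [NeZero N] (f : CuspForm (CongruenceSubgroup.Gamma0 N) 2)

/-- **`[m/A]⁻_f` depends on `m mod A`**: if `(m : ℤ/A) = x` then `[m/A]⁻ = [x.val/A]⁻` (periodicity `[r + n]⁻ = [r]⁻`,
tree `ratMinusSymbol_add_intCast`). [cite: MazurTateTeitelbaum1986Invent, §I.4 (4.2)] -/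
theorem ratMinusSymbol_intCast_div_eq_of_cast_eq {A : ℕ} [NeZero A] (m : ℤ) (x : ZMod A) (hx : (m : ZMod A) = x) :
    ratMinusSymbol f ((m : ℚ) / A) = ratMinusSymbol f ((x.val : ℚ) / A) := by
  have hA : (A : ℚ) ≠ 0 := Nat.cast_ne_zero.mpr (NeZero.ne A)
  have hdvd : (A : ℤ) ∣ (x.val : ℤ) - m := by
    rw [← ZMod.intCast_eq_intCast_iff_dvd_sub, hx, Int.cast_natCast, ZMod.natCast_zmod_val]
  obtain ⟨k, hk⟩ := hdvd
  have hm : (m : ℚ) / A = (x.val : ℚ) / A + ((-k : ℤ) : ℚ) := by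
    have : (m : ℤ) = x.val - A * k := by linear_combination -hk
    rw [this]; push_cast; field_simp; ring
  rw [hm, ratMinusSymbol_add_intCast]

/-- **Kato's four cusps as residue classes** (`A = 2^e`, or any `A`): for the cusp class `a`, an integer `c` with class `cb`, a class
`db ∈ (ℤ/A)^×` (of `d`) and `d′ := (db⁻¹).val`:
`[a.val·1/A]⁻ = [(a·1).val/A]⁻`, `[a.val·c/A]⁻ = [(a·cb).val/A]⁻`, `[a.val·d′/A]⁻ = [(a·db⁻¹).val/A]⁻`, `[a.val·c·d′/A]⁻ = [(a·cb·db⁻¹).val/A]⁻`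
— the arguments of `Kato2004.EulerSystemValues.cuspFactor f true χ c d a.val A d′` are the values of `b ↦ [(a·b).val/A]⁻` at
`b = 1, cb, db⁻¹, cb·db⁻¹` (the `t` of `CuspEval.exists_cuspElement_not_mem_of_rohrlich`, up to the scaling `D`).
[cite: Kato2004Asterisque, Thm. 6.6 (1) (p. 163), Lemma 13.10 (1) (p. 230)] -/
theorem ratMinusSymbol_kato_cusps {A : ℕ} [NeZero A] (a cb db : (ZMod A)ˣ) (c : ℤ) (hc : (c : ZMod A) = cb) :
    ratMinusSymbol f ((((a : ZMod A).val : ℤ) : ℚ) / A) = ratMinusSymbol f ((((a * 1 : (ZMod A)ˣ) : ZMod A).val : ℚ) / A) ∧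
    ratMinusSymbol f ((((a : ZMod A).val : ℤ) * c : ℚ) / A) = ratMinusSymbol f ((((a * cb : (ZMod A)ˣ) : ZMod A).val : ℚ) / A) ∧
    ratMinusSymbol f ((((a : ZMod A).val : ℤ) * (((db⁻¹ : (ZMod A)ˣ) : ZMod A).val : ℤ) : ℚ) / A) =
      ratMinusSymbol f ((((a * db⁻¹ : (ZMod A)ˣ) : ZMod A).val : ℚ) / A) ∧
    ratMinusSymbol f ((((a : ZMod A).val : ℤ) * c * (((db⁻¹ : (ZMod A)ˣ) : ZMod A).val : ℤ) : ℚ) / A) =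
      ratMinusSymbol f ((((a * cb * db⁻¹ : (ZMod A)ˣ) : ZMod A).val : ℚ) / A) := by
  refine ⟨?_, ?_, ?_, ?_⟩
  · rw [mul_one]
    exact_mod_cast ratMinusSymbol_intCast_div_eq_of_cast_eq f (((a : ZMod A).val : ℤ)) (a : ZMod A)
      (by rw [Int.cast_natCast, ZMod.natCast_zmod_val])
  · have h := ratMinusSymbol_intCast_div_eq_of_cast_eq f ((((a : ZMod A).val : ℤ)) * c) ((a * cb : (ZMod A)ˣ) : ZMod A)
      (by rw [Int.cast_mul, Int.cast_natCast, ZMod.natCast_zmod_val, hc, Units.val_mul])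
    exact_mod_cast h
  · have h := ratMinusSymbol_intCast_div_eq_of_cast_eq f
      ((((a : ZMod A).val : ℤ)) * (((db⁻¹ : (ZMod A)ˣ) : ZMod A).val : ℤ)) ((a * db⁻¹ : (ZMod A)ˣ) : ZMod A)
      (by rw [Int.cast_mul, Int.cast_natCast, Int.cast_natCast, ZMod.natCast_zmod_val, ZMod.natCast_zmod_val, Units.val_mul])
    exact_mod_cast h
  · have h := ratMinusSymbol_intCast_div_eq_of_cast_eq f
      ((((a : ZMod A).val : ℤ)) * c * (((db⁻¹ : (ZMod A)ˣ) : ZMod A).val : ℤ)) ((a * cb * db⁻¹ : (ZMod A)ˣ) : ZMod A)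
      (by rw [Int.cast_mul, Int.cast_mul, Int.cast_natCast, Int.cast_natCast, ZMod.natCast_zmod_val, ZMod.natCast_zmod_val, hc,
        Units.val_mul, Units.val_mul])
    exact_mod_cast h

end Cusps

/-! ## §2 The inverse `d′` modulo `A` -/

/-- With `d′ := (db⁻¹).val` for the class `db` of `d`: `d·d′ ≡ 1 (mod A)` — the `d′` of Kato's `“a/d”(A)` (Lemma 13.10 (1): «any integer `b`
such that `bd ≡ a mod A`»). [cite: Kato2004Asterisque, Lemma 13.10 (1) (p. 230)] -/
theorem intCast_mul_inv_val_modEq_one {A : ℕ} [NeZero A] (db : (ZMod A)ˣ) (d : ℤ) (hd : (d : ZMod A) = db) :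
    d * (((db⁻¹ : (ZMod A)ˣ) : ZMod A).val : ℤ) ≡ 1 [ZMOD (A : ℤ)] := by
  rw [← ZMod.intCast_eq_intCast_iff, Int.cast_mul, hd, Int.cast_natCast, ZMod.natCast_zmod_val, Int.cast_one, ← Units.val_mul,
    mul_inv_cancel, Units.val_one]

/-! ## §3 The guards of Kato's fact from coprimality -/

/-- `Nat.Coprime c (2·Qc)` with `3 ∣ Qc`... stated minimally: `c` prime to `2` and to `3` ⟹ `Int.gcd c (6·2·2^e) = 1` (Kato's `(c, 6pA) = 1` at
`p = 2`, `A = 2^e`). [cite: Kato2004Asterisque, Ex. 13.3 (p. 225)] -/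
theorem int_gcd_eq_one_of_coprime_two_three {c : ℕ} (h2 : Nat.Coprime c 2) (h3 : Nat.Coprime c 3) (e : ℕ) :
    Int.gcd (c : ℤ) (6 * 2 * 2 ^ e) = 1 := by
  have h : Nat.Coprime c (6 * 2 * 2 ^ e) := by
    rw [show (6 : ℕ) = 2 * 3 by norm_num]
    exact ((h2.mul_right h3).mul_right h2).mul_right (h2.pow_right e)
  have h' := Nat.isCoprime_iff_coprime.mpr h
  push_cast at h'
  exact Int.isCoprime_iff_gcd_eq_one.mp h'

/-- `d` prime to `2` and to `3N` ⟹ `Int.gcd d (6·2·N) = 1` (Kato's `(d, 6pN) = 1` at `p = 2`). [cite: Kato2004Asterisque, Ex. 13.3 (p. 225)] -/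
theorem int_gcd_eq_one_of_coprime_two_mul {d N : ℕ} (h : Nat.Coprime d (2 * (3 * N))) :
    Int.gcd (d : ℤ) (6 * 2 * N) = 1 := by
  have h2 : Nat.Coprime d 2 := Nat.Coprime.coprime_dvd_right (dvd_mul_right 2 _) h
  have h3N : Nat.Coprime d (3 * N) := Nat.Coprime.coprime_dvd_right (dvd_mul_left _ 2) h
  have h3 : Nat.Coprime d 3 := Nat.Coprime.coprime_dvd_right (dvd_mul_right 3 N) h3N
  have hN : Nat.Coprime d N := Nat.Coprime.coprime_dvd_right (dvd_mul_left N 3) h3N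
  have h' : Nat.Coprime d (6 * 2 * N) := by
    rw [show (6 : ℕ) = 2 * 3 by norm_num]
    exact ((h2.mul_right h3).mul_right h2).mul_right hN
  have h'' := Nat.isCoprime_iff_coprime.mpr h'
  push_cast at h''
  exact Int.isCoprime_iff_gcd_eq_one.mp h''

/-- Odd `c, d` ⟹ `Int.gcd (c·d) (2^k · 2^e) = 1` (the guard `Int.gcd (c·d) (cycLevel 2 k ∅ · A) = 1` of the value law (C5); note
`Kato2004.EulerSystemValues.cycLevel 2 k ∅ = 2^k`). [cite: Kato2004Asterisque, (8.1.2) (p. 180)] -/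
theorem int_gcd_mul_pow_two_eq_one {c d : ℕ} (hc : Nat.Coprime c 2) (hd : Nat.Coprime d 2) (k e : ℕ) :
    Int.gcd ((c : ℤ) * d) (2 ^ k * 2 ^ e) = 1 := by
  have h : Nat.Coprime (c * d) (2 ^ k * 2 ^ e) :=
    Nat.Coprime.mul_left ((hc.pow_right k).mul_right (hc.pow_right e)) ((hd.pow_right k).mul_right (hd.pow_right e))
  have h' := Nat.isCoprime_iff_coprime.mpr h
  push_cast at h'
  exact Int.isCoprime_iff_gcd_eq_one.mp h'

/-- `cycLevel 2 k ∅ = 2^k` (empty tame part). [cite: Kato2004Asterisque, §13.1 (p. 224)] -/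
theorem cycLevel_empty (p k : ℕ) : Kato2004.EulerSystemValues.cycLevel p k ∅ = p ^ k := by
  rw [Kato2004.EulerSystemValues.cycLevel, Finset.prod_empty, mul_one]

/-- From `Nat.Coprime c (2·Qc)` (the output of `exists_cuspElement_not_mem`) the two coprimality components. [folklore] -/
theorem coprime_two_and_of_coprime_two_mul {c Q : ℕ} (h : Nat.Coprime c (2 * Q)) : Nat.Coprime c 2 ∧ Nat.Coprime c Q :=
  ⟨Nat.Coprime.coprime_dvd_right (dvd_mul_right 2 Q) h, Nat.Coprime.coprime_dvd_right (dvd_mul_left Q 2) h⟩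

end Summit.BirchSwinnertonDyer.BirchSwinnertonDyer.Theorems.SignedKatoOffTwo.CuspEval

end
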